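import Literature.Geometry.Symplectic.OrigamiCollarMoserPrelim
import Literature.Geometry.Symplectic.OrigamiMoserFieldLocal
import Literature.Geometry.Symplectic.OrigamiModelForm
import Literature.Geometry.Kaehler.FibrePrimitiveProductSmooth
import HarnessLib

/-!
# The origami Moser argument, X: the Moser data of a kernel-adapted collar

Tenth file of the proof of the named fact `Literature.Geometry.Symplectic.exists_origamiCollarNormalForm`
(Cannas da Silva–Guillemin–Woodward 2000, Thm. 1).  From a smooth closed `2`-form `Ω₀` on the
collar `N × ℝ` (the collar form `c^*ω`), the restriction `ωZ` of `ω` to the fold, a smooth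
`1`-form `α` with `α(X) = 1` on the null direction `X` (the kernel line of `ωZ`), with `Ω₀`
agreeing on the zero section with the model form `ω₁ = pr^*ωZ + d(t² pr^*α)`
(`OrigamiModelForm.lean`), killing `∂_t` there, restricting horizontally to `ωZ`, and with
POSITIVE first-order coefficient `∂_t|₀ Ω₀((0,1),(X,0))`, this file builds the Moser data
(`MoserData`, `OrigamiMoserFieldLocal.lean`) of the segment from `Ω₀` to `ω₁`
(`exists_moserData_of_collar`): `μ = fibrePrimitive (ω₁ - Ω₀)` (smooth, `dμ = ω₁ - Ω₀` by the
relative Poincaré lemma `mextDeriv_fibrePrimitive`, flat along the zero section by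
`hasDerivAt_fibreCurve_fibrePrimitive`), the kernel and first-order clauses (the model's
coefficient is `2 α(X) = 2`, `modelForm_apply_inr_inl`).

Everything here is proved; no facts.

## References

* A. Cannas da Silva, V. Guillemin, C. Woodward, *On the unfolding of folded symplectic
  structures*, Math. Res. Lett. 7 (2000), proof of Thm. 1. [CannasGuilleminWoodward2000]
* D. McDuff, D. Salamon, *Introduction to Symplectic Topology*, 3rd ed. (2017), §3.2.
  [McDuffSalamon2017]
-/

noncomputable section

open scoped Manifold ContDiff Topology
open Set Function Filter
open Literature.Geometry.Kaehler Literature.Geometry.Manifold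

namespace Literature.Geometry.Symplectic

namespace OrigamiMoser

local notation "E3" => EuclideanSpace ℝ (Fin 3)
local notation "F4" => EuclideanSpace ℝ (Fin 3) × ℝ
local notation "I34" => ModelWithCorners.prod (𝓡 3) 𝓘(ℝ, ℝ)

variable {N : Type*} [TopologicalSpace N] [ChartedSpace (EuclideanSpace ℝ (Fin 3)) N]

/-- **The model form** `ω₁ = pr^*ωZ + d(t² pr^*α)` on `N × ℝ` (`OrigamiModelForm.lean`, named).
[cite: CannasGuilleminWoodward2000, Thm. 1] -/
def modelF (ωZ : MForm (𝓡 3) N ℝ 2) (α : MForm (𝓡 3) N ℝ 1) : MForm I34 (N × ℝ) ℝ 2 :=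
  ωZ.pullback I34 (Prod.fst : N × ℝ → N) +
    mextDeriv ((fun q : N × ℝ => q.2 ^ 2) • α.pullback I34 (Prod.fst : N × ℝ → N))

/-- Evaluating the derivative of a differentiable curve of forms on fixed vectors commutes with
the derivative. [folklore] -/
theorem deriv_apply_curve {C : ℝ → F4 [⋀^Fin 2]→L[ℝ] ℝ} (hC : DifferentiableAt ℝ C 0)
    (V : Fin 2 → F4) : deriv (fun t => C t V) 0 = deriv C 0 V := by
  have h := ((ContinuousAlternatingMap.apply ℝ F4 ℝ V).hasFDerivAt.comp_hasDerivAt (0 : ℝ)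
    hC.hasDerivAt).deriv
  exact h

/-- A `2`-form on `ℝ³` whose null vectors form exactly a line is non-zero (so its product
extension is non-zero). [folklore] -/
theorem ne_zero_of_null_iff {β : E3 [⋀^Fin 2]→L[ℝ] ℝ} {X : E3} (hX : X ≠ 0)
    (hnull : ∀ v : E3, (∀ w, β ![v, w] = 0) ↔ ∃ c : ℝ, v = c • X) : β ≠ 0 := by
  intro hβ
  -- every vector is then null, hence a multiple of `X`: the span of `X` is everything
  have hall : ∀ v : E3, ∃ c : ℝ, v = c • X := fun v => (hnull v).1 (fun w => by rw [hβ]; rfl)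
  have htop : Submodule.span ℝ ({X} : Set E3) = ⊤ := by
    rw [eq_top_iff]
    intro v _
    obtain ⟨c, rfl⟩ := hall v
    exact Submodule.smul_mem _ c (Submodule.subset_span rfl)
  have h1 : Module.finrank ℝ (Submodule.span ℝ ({X} : Set E3)) = 1 := finrank_span_singleton hX
  rw [htop, finrank_top, finrank_euclideanSpace_fin] at h1
  omega

/-- Additivity of a `2`-form in the second argument. [folklore] -/
theorem alt2_add_right' {V : Type*} [NormedAddCommGroup V] [NormedSpace ℝ V] (C : V [⋀^Fin 2]→L[ℝ] ℝ)
    (a b c : V) : C ![a, b + c] = C ![a, b] + C ![a, c] := by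
  rw [Kaehler.cam₂_swap C a (b + c), C.vecCons_add ![a] b c, Kaehler.cam₂_swap C b a,
    Kaehler.cam₂_swap C c a]
  ring

/-- Homogeneity of a `2`-form in the second argument. [folklore] -/
theorem alt2_smul_right' {V : Type*} [NormedAddCommGroup V] [NormedSpace ℝ V] (C : V [⋀^Fin 2]→L[ℝ] ℝ)
    (a : V) (r : ℝ) (b : V) : C ![a, r • b] = r * C ![a, b] := by
  rw [Kaehler.cam₂_swap C a (r • b), C.vecCons_smul ![a] r b, Kaehler.cam₂_swap C b a,
    smul_eq_mul]
  ring

variable [IsManifold (𝓡 3) ∞ N]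

/-- **The Moser data of a kernel-adapted collar.**  Hypotheses: `Ω₀` smooth and closed,
`ωZ` and `α` smooth with `ωZ` closed, `α(X) = 1`, `X ≠ 0` spanning the null vectors of `ωZ`;
along the zero section `Ω₀` agrees with the model form `modelF ωZ α`, kills `(0,1)` and restricts
horizontally to `ωZ`; and the first-order coefficient `∂_t|₀ Ω₀((0,1),(X,0))` is positive.
Conclusion: Moser data `D` with `D.Ω₀ = Ω₀`, `D.Ωs 1 = modelF ωZ α`, `D.X = X`.
[cite: CannasGuilleminWoodward2000, proof of Thm. 1] -/
theorem exists_moserData_of_collar {Ω₀ : MForm I34 (N × ℝ) ℝ 2} {ωZ : MForm (𝓡 3) N ℝ 2}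
    {α : MForm (𝓡 3) N ℝ 1} {X : N → E3}
    (hΩs : IsSmoothForm Ω₀) (hΩc : IsClosedForm Ω₀) (hωZs : IsSmoothForm ωZ) (hωZc : IsClosedForm ωZ)
    (hαs : IsSmoothForm α) (hαX : ∀ n, α n ![X n] = 1) (hX : ∀ n, X n ≠ 0)
    (hnull : ∀ (n : N) (v : E3), (∀ w, ωZ n ![v, w] = 0) ↔ ∃ c : ℝ, v = c • X n)
    (hagree : ∀ n, Ω₀ (n, 0) = modelF ωZ α (n, 0))
    (hvert : ∀ (n : N) (W : F4), Ω₀ (n, 0) ![vVec, W] = 0)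
    (hhor : ∀ (n : N) (v v' : E3), Ω₀ (n, 0) ![((v, 0) : F4), ((v', 0) : F4)] = ωZ n ![v, v'])
    (hpos : ∀ n, 0 < deriv (fun t : ℝ => Ω₀ (n, t) ![vVec, ((X n, 0) : F4)]) 0) :
    ∃ D : MoserData N, D.Ω₀ = Ω₀ ∧ D.Ωs 1 = modelF ωZ α ∧ D.X = X := by
  -- the model form and the difference
  have hΩ₁s : IsSmoothForm (modelF ωZ α) := isSmoothForm_modelForm hωZs hαs
  have hΩ₁c : IsClosedForm (modelF ωZ α) := isClosedForm_modelForm hωZs hωZc hαs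
  set η : MForm I34 (N × ℝ) ℝ 2 := modelF ωZ α - Ω₀ with hη
  have hηs : IsSmoothForm η := (isSmoothForm_iff_smoothAt η).2 fun x =>
    ((isSmoothForm_iff_smoothAt _).1 hΩ₁s x).sub ((isSmoothForm_iff_smoothAt _).1 hΩs x)
  have hΩns : IsSmoothForm (-Ω₀) := (isSmoothForm_iff_smoothAt _).2 fun x =>
    ((isSmoothForm_iff_smoothAt _).1 hΩs x).neg
  have hη0 : ∀ n, η (n, 0) = 0 := fun n => by
    show modelF ωZ α (n, 0) - Ω₀ (n, 0) = 0
    rw [hagree, sub_self]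
  have hηc : ∀ z : N × ℝ, mextDeriv η z = 0 := by
    intro z
    have h : mextDeriv η = 0 := by
      show mextDeriv (modelF ωZ α - Ω₀) = 0
      rw [sub_eq_add_neg, mextDeriv_add hΩ₁s hΩns, show -Ω₀ = (-1 : ℝ) • Ω₀ by simp, mextDeriv_smul]
      have h1 : mextDeriv (modelF ωZ α) = 0 := hΩ₁c
      have h2 : mextDeriv Ω₀ = 0 := hΩc
      rw [h1, h2, smul_zero, add_zero]
    rw [h]; rfl
  -- the primitive
  set μ : MForm I34 (N × ℝ) ℝ 1 := fibrePrimitive η with hμ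
  have hμsAt : ∀ x : N × ℝ, μ.SmoothAt x := fun x =>
    smoothAt_fibrePrimitive (J := univ) isOpen_univ (fun _ _ _ _ => mem_univ _)
      (fun z _ => (isSmoothForm_iff_smoothAt η).1 hηs z) (mem_univ _)
  have hμs : IsSmoothForm μ := (isSmoothForm_iff_smoothAt μ).2 hμsAt
  have hdμ : mextDeriv μ = η := by
    funext x
    exact mextDeriv_fibrePrimitive (J := univ) isOpen_univ (fun _ _ _ _ => mem_univ _)
      (fun z _ => (isSmoothForm_iff_smoothAt η).1 hηs z) (fun z _ => hηc z) hη0 (mem_univ _)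
  -- horizontality of `X` for `Ω₀` along the zero section
  have hXnull : ∀ n w, ωZ n ![X n, w] = 0 := fun n => (hnull n (X n)).2 ⟨1, (one_smul ℝ _).symm⟩
  have hvert' : ∀ (n : N) (W : F4), fibreCurve Ω₀ n 0 ![vVec, W] = 0 := hvert
  have hhor' : ∀ (n : N) (v v' : E3), fibreCurve Ω₀ n 0 ![((v, 0) : F4), ((v', 0) : F4)] = ωZ n ![v, v'] := hhor
  have hkerX : ∀ (n : N) (W : F4), fibreCurve Ω₀ n 0 ![((X n, 0) : F4), W] = 0 := by
    intro n W
    have hW : W = ((W.1, 0) : F4) + W.2 • vVec := by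
      ext <;> simp [vVec]
    rw [hW, alt2_add_right', alt2_smul_right', hhor', hXnull,
      Kaehler.cam₂_swap (fibreCurve Ω₀ n 0) _ vVec, hvert']
    ring
  -- `Ω₀ (n, 0) ≠ 0`
  have hne : ∀ n, fibreCurve Ω₀ n 0 ≠ 0 := by
    intro n h0
    apply ne_zero_of_null_iff (hX n) (hnull n)
    ext m
    have hm : m = ![m 0, m 1] := by
      funext i; fin_cases i <;> rfl
    rw [hm, ← hhor', h0]
    rfl
  -- `Ω₀ + dμ = ω₁`
  have hsum : Ω₀ + mextDeriv μ = modelF ωZ α := by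
    rw [hdμ]
    funext x
    show Ω₀ x + (modelF ωZ α x - Ω₀ x) = modelF ωZ α x
    abel
  -- the first-order coefficients
  have hpos₀ : ∀ n, 0 < deriv (fibreCurve Ω₀ n) 0 ![vVec, ((X n, 0) : F4)] := by
    intro n
    rw [← deriv_apply_curve (((contDiff_fibreCurve hΩs n).differentiable (by simp)) 0)]
    exact hpos n
  have hpos₁ : ∀ n, 0 < deriv (fibreCurve (Ω₀ + mextDeriv μ) n) 0 ![vVec, ((X n, 0) : F4)] := by
    intro n
    rw [hsum, ← deriv_apply_curve (((contDiff_fibreCurve hΩ₁s n).differentiable (by simp)) 0)]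
    have hfun : (fun t : ℝ => fibreCurve (modelF ωZ α) n t ![vVec, ((X n, 0) : F4)]) = fun t : ℝ => 2 * t := by
      funext t
      have h := modelForm_apply_inr_inl ωZ hαs n t (X n)
      rw [hαX, mul_one] at h
      exact h
    rw [hfun]
    have hd : HasDerivAt (fun t : ℝ => 2 * t) 2 0 := by
      simpa using (hasDerivAt_id (0 : ℝ)).const_mul (2 : ℝ)
    rw [hd.deriv]
    norm_num
  have hσ0 : ∀ n, mextDeriv μ (n, 0) = 0 := fun n => by rw [hdμ]; exact hη0 n
  let D : MoserData N :=
    { Ω₀ := Ω₀, μ := μ, X := X, smooth_Ω₀ := hΩs, closed_Ω₀ := hΩc, smooth_μ := hμs,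
      σ_zero := hσ0, μ_zero := fibrePrimitive_apply_zero η,
      μ_flat := hasDerivAt_fibreCurve_fibrePrimitive hηs hη0, X_ne := hX, ker_v := hvert',
      ker_X := hkerX, Ω₀_ne := hne, pos₀ := hpos₀, pos₁ := hpos₁ }
  refine ⟨D, rfl, ?_, rfl⟩
  show Ω₀ + (1 : ℝ) • mextDeriv μ = modelF ωZ α
  rw [one_smul, hsum]

end OrigamiMoser


end Literature.Geometry.Symplectic

end
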